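import HarnessLib
import Summits.RiemannHypothesis.RiemannHypothesis.Theses.SignCone
import Summits.RiemannHypothesis.RiemannHypothesis.Theorems.SignConeSignConeInequalityCriterion
import Literature.NumberTheory.LFunctions.WeilArchimedeanPositivityProofs

/-!
# Route SignCone, support `ExactConeRigidity` (stmt-RiemannHypothesis-16306): CLOSED by the banked criterion

The item asks: if the prime-free sign-cone inequality holds WITHOUT slack at every cutoff —
`0 ≤ Re W_ar(F)` for every node-nonnegative `F` in the Weil cone `P(a)`, all `a > 0` — then the
Riemann Hypothesis. Since `F(0) = Σ_i (g_i ⋆ g̃_i)(0) = Σ_i ‖g_i‖₂² ≥ 0`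
(`weilConv_weilReflect_apply_zero`), the exact inequality implies the UNIT-SLACK inequality
`-Re F(0) ≤ Re W_ar(F)`, i.e. the route target `SignConeInequality` (X), and X implies RH by the
criterion banked in `SignConeSignConeInequalityCriterion.lean`
(`riemannHypothesis_of_signConeInequality` = the deciding theorem `closes` over the CLOSED cruxes
`ConeMagnification` (W-MAG, stmt-16303) and `SignConeDuality` (stmt-16304)).

* `re_autocorrSum_apply_zero_nonneg` — `0 ≤ Re F(0)` for `F = Σ_i g_i ⋆ g̃_i` (Mathlib-primitive form);
* `signConeInequality_of_exactSignCone` — exact sign-cone inequality at every cutoff ⟹ X;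
* `Theorems.exactConeRigidity_proof : Theses.SignCone.ExactConeRigidity` — closes the item.

Remark for the planner. This closes the support AS FILED through the magnification chain. The 2001
"(R)" path the informal text describes (rigidity `K = {Λ}` by W-COMP + W-SRPP, then
`weil_criterion_holds`) is a different theorem — `K_a ≠ ∅ ∀ a ⟹ c = Λ` — not implied by this file;
the landed `SignConeExactConeRigidity{Chain,KRH,…}` modules reduce it to a one-sided abscissa theorem.
-/

noncomputable section

-- `Summit.RiemannHypothesis.RiemannHypothesis.…` repeats a namespace component by design (D-0017 layout).
set_option linter.dupNamespace false

open scoped BigOperators ComplexConjugate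
open MeasureTheory

namespace Summit.RiemannHypothesis.RiemannHypothesis.Theorems.SignCone

open Summit.RiemannHypothesis.RiemannHypothesis.Theses.SignCone
open Literature.NumberTheory.LFunctions

/-- `0 ≤ Re F(0)` for a finite sum of autocorrelations `F = Σ_i g_i ⋆ g̃_i`
(`(g ⋆ g̃)(0) = ‖g‖₂²`, Yoshida §2), in the Mathlib-primitive form of the route file. [folklore] -/
theorem re_autocorrSum_apply_zero_nonneg {k : ℕ} (g : Fin k → ℝ → ℂ) :
    0 ≤ ((fun t : ℝ => ∑ i, MeasureTheory.convolution (g i) (fun u => (starRingEnd ℂ) ((g i) (-u)))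
      (ContinuousLinearMap.mul ℂ ℂ) MeasureTheory.MeasureSpace.volume t) 0).re := by
  show 0 ≤ (∑ i, weilConv (g i) (weilReflect (g i)) 0).re
  rw [Complex.re_sum]
  refine Finset.sum_nonneg fun i _ => ?_
  rw [weilConv_weilReflect_apply_zero, Complex.ofReal_re]
  exact integral_nonneg fun t => by positivity

/-- **Exact ⟹ unit slack.** If `0 ≤ Re W_ar(F)` for every node-nonnegative `F ∈ P(a)` at every cutoff
`a > 0` (the hypothesis of `ExactConeRigidity`), then the route target `SignConeInequality`
(`-Re F(0) ≤ Re W_ar(F)`) holds, because `Re F(0) ≥ 0`. [folklore] -/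
theorem signConeInequality_of_exactSignCone
    (hE : ∀ a : ℝ, 0 < a → ∀ (k : ℕ) (g : Fin k → ℝ → ℂ),
      (∀ i, (ContDiff ℝ ((⊤ : ℕ∞) : WithTop ℕ∞) (g i) ∧ HasCompactSupport (g i)) ∧
        tsupport (g i) ⊆ Set.Icc (-a) a) →
      let F : ℝ → ℂ := fun t => ∑ i, MeasureTheory.convolution (g i)
        (fun u => (starRingEnd ℂ) ((g i) (-u))) (ContinuousLinearMap.mul ℂ ℂ)
        MeasureTheory.MeasureSpace.volume t
      (∀ n : ℕ, 2 ≤ n → 0 ≤ (F (Real.log n)).re) →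
      let M : ℂ → ℂ := fun s => ∫ u : ℝ, F u * Complex.exp ((s - 1 / 2) * u)
      0 ≤ (M 0 + M 1 + ((1 / (2 * Real.pi) : ℂ) * (∫ t : ℝ, M (1 / 2 + t * Complex.I) *
        ((Complex.digamma (1 / 4 + t / 2 * Complex.I)).re : ℂ)) - F 0 * (Real.log Real.pi : ℂ))).re) :
    SignConeInequality := by
  intro a ha k g hg F hnodes M
  have h := hE a ha k g hg hnodes
  have h0 : 0 ≤ (F 0).re := re_autocorrSum_apply_zero_nonneg g
  simp only [F, M] at h h0 ⊢
  linarith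

end Summit.RiemannHypothesis.RiemannHypothesis.Theorems.SignCone

namespace Summit.RiemannHypothesis.RiemannHypothesis.Theorems

open Summit.RiemannHypothesis.RiemannHypothesis.Theorems.SignCone

/-- **The support `SignCone.ExactConeRigidity`, proved** (stmt-RiemannHypothesis-16306): the exact
(slack-free) prime-free sign-cone inequality at every cutoff implies the Riemann Hypothesis — exact ⟹
unit slack (`signConeInequality_of_exactSignCone`) ⟹ RH (`riemannHypothesis_of_signConeInequality`,
the banked criterion over the closed cruxes `ConeMagnification` and `SignConeDuality`). [folklore] -/
theorem exactConeRigidity_proof :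
    Summit.RiemannHypothesis.RiemannHypothesis.Theses.SignCone.ExactConeRigidity :=
  fun hE => riemannHypothesis_of_signConeInequality (signConeInequality_of_exactSignCone hE)

end Summit.RiemannHypothesis.RiemannHypothesis.Theorems

end
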